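import Mathlib
import HarnessLib

/-!
# Filon's method for finite Fourier integrals (Davis–Rabinowitz 1984, Sect. 2.10.2)

Davis–Rabinowitz, *Methods of Numerical Integration* (2nd ed., 1984), Sect. 2.10.2 "Use of Approximation: Filon's
Method for Finite Fourier Integrals" (held OCR PDF pp. 125–126). THE PRINCIPLE **(2.10.2.1)–(2.10.2.3)**: if
`f = a_1 φ_1 + ⋯ + a_n φ_n + ε` on `[a, b]` with `ε` small and the transforms `ψ_k(t) = ∫_a^b φ_k(x) K(t, x) dx`
explicitly computable, then `I(t) = ∫_a^b f K = Σ a_k ψ_k(t) + ∫_a^b ε K ≈ Σ a_k ψ_k(t)`. FILON: `[a, b]` is cut into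
`2N` panels of length `h = (b - a)/2N` **(2.10.2.5)**, `f` is replaced by the parabola interpolating it on each double
panel, and the Fourier integrals of the parabolas are evaluated exactly; with the sums
`C_{2N} = ½ f(a) cos ka + f(a+2h) cos k(a+2h) + ⋯ + ½ f(b) cos kb` **(2.10.2.6)**,
`C_{2N-1} = f(a+h) cos k(a+h) + f(a+3h) cos k(a+3h) + ⋯ + f(b-h) cos k(b-h)` **(2.10.2.7)** (and `S_{2N}`, `S_{2N-1}`
with `sin`), `θ = kh` **(2.10.2.8)** and
`α(θ) = (θ² + θ sin θ cos θ - 2 sin² θ)/θ³`, `β(θ) = 2[θ(1 + cos² θ) - 2 sin θ cos θ]/θ³`,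
`γ(θ) = 4(sin θ - θ cos θ)/θ³` **(2.10.2.9)**, Filon's rules are
`∫_a^b f(t) cos kt dt ≈ h{α[f(b) sin kb - f(a) sin ka] + β C_{2N} + γ C_{2N-1}}`,
`∫_a^b f(t) sin kt dt ≈ h{-α[f(b) cos kb - f(a) cos ka] + β S_{2N} + γ S_{2N-1}}` **(2.10.2.10)**; for small `θ`,
`α = 2θ³/45 - ⋯`, `β = 2/3 + 2θ²/15 - ⋯`, `γ = 4/3 - 2θ²/15 + ⋯` **(2.10.2.11)**, "thus for `θ = 0`, Filon's rule
reduces to an `N × S` rule"; if `max |f - p_2| ≤ ε` for a piecewise quadratic `p_2` on the mesh, "a uniform bound on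
the error in Filon's method is given by `(b - a)ε`"; and with `H(θ)` **(2.10.2.12a)**, `M = max |f'''|`
**(2.10.2.12b)**, `|E_S|, |E_C| ≤ (b - a) M H(θ) h³ + O(h⁴)` for `θ < 1` **(2.10.2.12c)**.

What is formalised (Mathlib only):

* the objects: `filonAlpha`, `filonBeta`, `filonGamma` (2.10.2.9), the mesh sums `filonEvenSum` / `filonOddSum`
  ((2.10.2.6)–(2.10.2.7), for an arbitrary weight `w = cos k·` or `sin k·`), Filon's cosine and sine rules
  `filonCos`, `filonSin` (2.10.2.10) with the coefficient triple as a parameter (so that both (2.10.2.9) and the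
  small-`θ` values (2.10.2.11) can be plugged in), and `filonH` (2.10.2.12a);
* PROVED: the principle (2.10.2.3) as an exact identity `∫ f K = Σ a_k ψ_k + ∫ ε K` (`filon_integral_eq_sum_transforms`);
  the uniform error bound `|∫_a^b ε(x) w(x) dx| ≤ (b - a) E` for `|ε| ≤ E`, `|w| ≤ 1` (`filon_abs_integral_mul_le`),
  whence the text's bound: IF a rule integrates `p_2 cos k·` exactly and `|f - p_2| ≤ ε` on `[a, b]`, its error on
  `f` is at most `(b - a)ε` (`filon_error_le_of_exact`); and "for `θ = 0` Filon's rule reduces to an `N × S` rule":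
  with `k = 0` and the limiting coefficients `β = 2/3`, `γ = 4/3` (any `α`), `filonCos` IS the compound Simpson rule
  on the `2N` panels (`filonCos_zero_eq_simpson`), while `filonSin` (with `α(0) = 0`) vanishes (`filonSin_zero`);
* NAMED FACTS (cited, not proved): `FilonExact` — (2.10.2.10) with (2.10.2.9) is exact for integrands `p cos kt`,
  `p sin kt` with `p` quadratic on each double panel (`θ ≠ 0`), the construction principle; `FilonSmallTheta` — the
  limits (2.10.2.11) at `θ → 0`; `FilonErrorBound` — (2.10.2.12c) in the form "`≤ (b-a) M H(θ) h³ + C h⁴`".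

Not formalised: the parabolic interpolation itself, Håvie's exact error expansion, Flinn's and Luke's extensions.

SIBLING IN THE CERTIFICATE LANE (disclosed, not imported): `Literature/Analysis/ValidatedNumerics/
TaylorModelIntegralCertOscillatory.lean` ("Filon-type product integration against an oscillatory weight, with
kernel-checked certificates") already cites Sect. 2.10.2 for the PRINCIPLE (2.10.2.1)–(2.10.2.3) and the `(b - a)ε`
remainder, formalised there for straight-line-program integrands enclosed by Taylor models (`OSegOK`,
`abs_integral_mul_weight_sub_le`, Iserles' Filon-type method `Q_h^F[f] = I_h[f̃]`). The present module records the
CLASSICAL FILON RULE itself — the coefficients `α, β, γ` (2.10.2.9), the sums (2.10.2.6)–(2.10.2.7), the rules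
(2.10.2.10), the `θ = 0` reduction to Simpson and the named facts — none of which that module contains; the two
generic lemmas `filon_integral_eq_sum_transforms` / `filon_abs_integral_mul_le` below are the textbook identities
over plain real functions (different statements from the certificate objects there), kept so that the error bound
`filon_error_le_of_exact` is self-contained.
-/

open Finset MeasureTheory Real Filter Topology
open scoped Interval

namespace Literature.Analysis.Quadrature

/-! ## Filon's coefficients and rules -/

/-- `α(θ) = (θ² + θ sin θ cos θ - 2 sin² θ)/θ³` **(2.10.2.9)**. [cite: DavisRabinowitz1984, Sect. 2.10.2 (2.10.2.9)] -/
noncomputable def filonAlpha (θ : ℝ) : ℝ := (θ ^ 2 + θ * sin θ * cos θ - 2 * sin θ ^ 2) / θ ^ 3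

/-- `β(θ) = 2[θ(1 + cos² θ) - 2 sin θ cos θ]/θ³` **(2.10.2.9)**. [cite: DavisRabinowitz1984, Sect. 2.10.2 (2.10.2.9)] -/
noncomputable def filonBeta (θ : ℝ) : ℝ := 2 * (θ * (1 + cos θ ^ 2) - 2 * sin θ * cos θ) / θ ^ 3

/-- `γ(θ) = 4(sin θ - θ cos θ)/θ³` **(2.10.2.9)**. [cite: DavisRabinowitz1984, Sect. 2.10.2 (2.10.2.9)] -/
noncomputable def filonGamma (θ : ℝ) : ℝ := 4 * (sin θ - θ * cos θ) / θ ^ 3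

/-- The even mesh sum **(2.10.2.6)** for a weight `w` (`w = cos k·` gives `C_{2N}`, `w = sin k·` gives `S_{2N}`):
`½ f(a)w(a) + Σ_{j=1}^{N-1} f(a+2jh) w(a+2jh) + ½ f(a+2Nh) w(a+2Nh)`.
[cite: DavisRabinowitz1984, Sect. 2.10.2 (2.10.2.6)] -/
noncomputable def filonEvenSum (f w : ℝ → ℝ) (a h : ℝ) (N : ℕ) : ℝ :=
  f a * w a / 2 + ∑ j ∈ Ico 1 N, f (a + 2 * j * h) * w (a + 2 * j * h) +
    f (a + 2 * N * h) * w (a + 2 * N * h) / 2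

/-- The odd mesh sum **(2.10.2.7)**: `Σ_{j=0}^{N-1} f(a+(2j+1)h) w(a+(2j+1)h)` (`C_{2N-1}`, `S_{2N-1}`).
[cite: DavisRabinowitz1984, Sect. 2.10.2 (2.10.2.7)] -/
noncomputable def filonOddSum (f w : ℝ → ℝ) (a h : ℝ) (N : ℕ) : ℝ :=
  ∑ j ∈ range N, f (a + (2 * j + 1) * h) * w (a + (2 * j + 1) * h)

/-- Filon's COSINE rule **(2.10.2.10)** on `2N` panels of length `h = (b-a)/2N`, with coefficient triple
`(α, β, γ)` (plug in `filonAlpha θ, filonBeta θ, filonGamma θ`, `θ = kh`, or the small-`θ` values (2.10.2.11)):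
`h{α[f(b) sin kb - f(a) sin ka] + β C_{2N} + γ C_{2N-1}}`. [cite: DavisRabinowitz1984, Sect. 2.10.2 (2.10.2.10)] -/
noncomputable def filonCos (f : ℝ → ℝ) (a b : ℝ) (N : ℕ) (k α β γ : ℝ) : ℝ :=
  let h := (b - a) / (2 * N)
  h * (α * (f b * sin (k * b) - f a * sin (k * a)) + β * filonEvenSum f (fun t => cos (k * t)) a h N +
    γ * filonOddSum f (fun t => cos (k * t)) a h N)

/-- Filon's SINE rule **(2.10.2.10)**: `h{-α[f(b) cos kb - f(a) cos ka] + β S_{2N} + γ S_{2N-1}}`.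
[cite: DavisRabinowitz1984, Sect. 2.10.2 (2.10.2.10)] -/
noncomputable def filonSin (f : ℝ → ℝ) (a b : ℝ) (N : ℕ) (k α β γ : ℝ) : ℝ :=
  let h := (b - a) / (2 * N)
  h * (-α * (f b * cos (k * b) - f a * cos (k * a)) + β * filonEvenSum f (fun t => sin (k * t)) a h N +
    γ * filonOddSum f (fun t => sin (k * t)) a h N)

/-- `H(θ) = |sin θ/(3θ²) + cos θ/θ³ - sin θ/θ⁴|` **(2.10.2.12a)**. [cite: DavisRabinowitz1984, Sect. 2.10.2 (2.10.2.12a)] -/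
noncomputable def filonH (θ : ℝ) : ℝ := |sin θ / (3 * θ ^ 2) + cos θ / θ ^ 3 - sin θ / θ ^ 4|

/-! ## The principle (2.10.2.1)–(2.10.2.3) and the uniform error bound -/

/-- THE PRINCIPLE, as an exact identity **(2.10.2.3)**: if `f = Σ_k a_k φ_k + ε` on `[a, b]` (all pieces integrable),
then `∫_a^b f K = Σ_k a_k ψ_k + ∫_a^b ε K` with the transforms `ψ_k = ∫_a^b φ_k K` **(2.10.2.2)**.
[cite: DavisRabinowitz1984, Sect. 2.10.2 (2.10.2.1)-(2.10.2.3)] -/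
theorem filon_integral_eq_sum_transforms {ι : Type*} (s : Finset ι) {a b : ℝ} (hab : a ≤ b)
    {f ε K : ℝ → ℝ} {φ : ι → ℝ → ℝ} {c : ι → ℝ}
    (hf : ∀ x ∈ Set.Icc a b, f x = ∑ i ∈ s, c i * φ i x + ε x)
    (hφ : ∀ i ∈ s, IntervalIntegrable (fun x => φ i x * K x) volume a b)
    (hε : IntervalIntegrable (fun x => ε x * K x) volume a b) :
    ∫ x in a..b, f x * K x = ∑ i ∈ s, c i * (∫ x in a..b, φ i x * K x) + ∫ x in a..b, ε x * K x := by
  have hcongr : ∫ x in a..b, f x * K x = ∫ x in a..b, ((∑ i ∈ s, c i * (φ i x * K x)) + ε x * K x) := by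
    refine intervalIntegral.integral_congr fun x hx => ?_
    rw [Set.uIcc_of_le hab] at hx
    rw [hf x hx, add_mul, Finset.sum_mul]
    congr 1
    refine Finset.sum_congr rfl fun i _ => ?_
    ring
  have hsum : IntervalIntegrable (fun x => ∑ i ∈ s, c i * (φ i x * K x)) volume a b := by
    have h := IntervalIntegrable.sum s fun i hi => (hφ i hi).const_mul (c i)
    rwa [Finset.sum_fn] at h
  rw [hcongr, intervalIntegral.integral_add hsum hε, intervalIntegral.integral_finsetSum]
  · congr 1
    refine Finset.sum_congr rfl fun i _ => ?_
    exact intervalIntegral.integral_const_mul _ _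
  · intro i hi
    exact (hφ i hi).const_mul (c i)

/-- The uniform error bound: `|∫_a^b ε(x) w(x) dx| ≤ (b - a) E` whenever `|ε| ≤ E` and `|w| ≤ 1` on `[a, b]`
(`w = cos k·`, `sin k·`). [cite: DavisRabinowitz1984, Sect. 2.10.2 (2.10.2.3)] -/
theorem filon_abs_integral_mul_le {a b E : ℝ} (hab : a ≤ b) {ε w : ℝ → ℝ}
    (hε : ∀ x ∈ Set.Icc a b, |ε x| ≤ E) (hw : ∀ x ∈ Set.Icc a b, |w x| ≤ 1) :
    |∫ x in a..b, ε x * w x| ≤ (b - a) * E := by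
  have hE : ∀ x ∈ Ι a b, ‖ε x * w x‖ ≤ E := by
    intro x hx
    rw [Set.uIoc_of_le hab] at hx
    have hx' : x ∈ Set.Icc a b := ⟨hx.1.le, hx.2⟩
    rw [Real.norm_eq_abs, abs_mul]
    have h1 := hε x hx'
    have h2 := hw x hx'
    have hE0 : 0 ≤ E := (abs_nonneg _).trans h1
    calc |ε x| * |w x| ≤ E * 1 := mul_le_mul h1 h2 (abs_nonneg _) hE0
      _ = E := mul_one E
  have := intervalIntegral.norm_integral_le_of_norm_le_const hE
  rw [Real.norm_eq_abs, abs_of_nonneg (sub_nonneg.mpr hab)] at this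
  linarith [this]

/-- The text's bound for Filon's method: IF a number `R` (Filon's rule applied to `f`, which by construction is the
exact integral of `p_2 cos k·` for the piecewise parabola `p_2` through the mesh values of `f`) equals
`∫_a^b p_2(t) cos kt dt`, and `|f - p_2| ≤ ε` on `[a, b]`, then `|∫_a^b f(t) cos kt dt - R| ≤ (b - a)ε` — "a uniform
bound on the error in Filon's method is given by `(b - a)ε`"; the same with `sin`.
[cite: DavisRabinowitz1984, Sect. 2.10.2 (2.10.2.10)] -/
theorem filon_error_le_of_exact {a b k eps R : ℝ} (hab : a ≤ b) {f p₂ w : ℝ → ℝ}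
    (hw : w = (fun t => cos (k * t)) ∨ w = (fun t => sin (k * t)))
    (hR : R = ∫ t in a..b, p₂ t * w t)
    (hf : IntervalIntegrable (fun t => f t * w t) volume a b)
    (hp : IntervalIntegrable (fun t => p₂ t * w t) volume a b)
    (heps : ∀ t ∈ Set.Icc a b, |f t - p₂ t| ≤ eps) :
    |(∫ t in a..b, f t * w t) - R| ≤ (b - a) * eps := by
  have hw1 : ∀ t ∈ Set.Icc a b, |w t| ≤ 1 := by
    intro t _
    rcases hw with rfl | rfl
    · exact abs_cos_le_one _
    · exact abs_sin_le_one _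
  have hsub : (∫ t in a..b, f t * w t) - R = ∫ t in a..b, (f t - p₂ t) * w t := by
    rw [hR, ← intervalIntegral.integral_sub hf hp]
    refine intervalIntegral.integral_congr fun t _ => ?_
    ring
  rw [hsub]
  exact filon_abs_integral_mul_le hab heps hw1

/-! ## `θ = 0`: Filon's rule reduces to the compound Simpson rule -/

/-- "Thus for `θ = 0`, Filon's rule reduces to an `N × S` rule": with `k = 0` and the limiting coefficients
`β(0) = 2/3`, `γ(0) = 4/3` of (2.10.2.11) (the value of `α` is immaterial since `sin 0 = 0`), Filon's cosine rule is
the compound Simpson rule `(h/3)[f(a) + 4 Σ_odd f + 2 Σ_even-interior f + f(b)]` on the `2N` panels.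
[cite: DavisRabinowitz1984, Sect. 2.10.2 (2.10.2.10)-(2.10.2.11)] -/
theorem filonCos_zero_eq_simpson (f : ℝ → ℝ) (a b : ℝ) (N : ℕ) (α : ℝ) :
    filonCos f a b N 0 α (2 / 3) (4 / 3) =
      (b - a) / (2 * N) / 3 * (f a + 4 * ∑ j ∈ range N, f (a + (2 * j + 1) * ((b - a) / (2 * N))) +
        2 * ∑ j ∈ Ico 1 N, f (a + 2 * j * ((b - a) / (2 * N))) + f (a + 2 * N * ((b - a) / (2 * N)))) := by
  simp only [filonCos, filonEvenSum, filonOddSum, zero_mul, sin_zero, cos_zero, mul_one, mul_zero, sub_zero,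
    zero_add]
  ring

/-- … and Filon's sine rule with `k = 0` and the limiting value `α(0) = 0` of (2.10.2.11) is `0` (as is
`∫ f sin 0t`); note that the `α`-term `-α[f(b) - f(a)]` would NOT vanish for `α ≠ 0`.
[cite: DavisRabinowitz1984, Sect. 2.10.2 (2.10.2.10)-(2.10.2.11)] -/
theorem filonSin_zero (f : ℝ → ℝ) (a b : ℝ) (N : ℕ) (β γ : ℝ) : filonSin f a b N 0 0 β γ = 0 := by
  simp [filonSin, filonEvenSum, filonOddSum]

/-- For `2N` panels ending at `b`: `a + 2N·h = b` when `h = (b - a)/2N`, `N ≠ 0` (so the last node of the even sum is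
`b`). [cite: DavisRabinowitz1984, Sect. 2.10.2 (2.10.2.5)] -/
theorem filon_last_node {a b : ℝ} {N : ℕ} (hN : N ≠ 0) : a + 2 * N * ((b - a) / (2 * N)) = b := by
  have : (N : ℝ) ≠ 0 := by exact_mod_cast hN
  field_simp
  ring

/-! ## Named facts -/

/-- FILON'S CONSTRUCTION PRINCIPLE (cited, NOT proved here): for `θ = kh ≠ 0` the rules (2.10.2.10) with the
coefficients (2.10.2.9) integrate `p(t) cos kt` and `p(t) sin kt` exactly over `[a, b]` whenever `p` is a quadratic
polynomial on each double panel `[a + 2jh, a + 2(j+1)h]` (continuous at the even nodes).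
[cite: DavisRabinowitz1984, Sect. 2.10.2 (2.10.2.9)-(2.10.2.10)] -/
def FilonExact (a b : ℝ) (N : ℕ) (k : ℝ) : Prop :=
  ∀ p : ℝ → ℝ, Continuous p →
    (∀ j < N, ∃ q : Polynomial ℝ, q.natDegree ≤ 2 ∧
      ∀ t ∈ Set.Icc (a + 2 * j * ((b - a) / (2 * N))) (a + 2 * (j + 1) * ((b - a) / (2 * N))), p t = q.eval t) →
    N ≠ 0 → k * ((b - a) / (2 * N)) ≠ 0 →
      (∫ t in a..b, p t * cos (k * t)) =
          filonCos p a b N k (filonAlpha (k * ((b - a) / (2 * N)))) (filonBeta (k * ((b - a) / (2 * N))))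
            (filonGamma (k * ((b - a) / (2 * N)))) ∧
      (∫ t in a..b, p t * sin (k * t)) =
          filonSin p a b N k (filonAlpha (k * ((b - a) / (2 * N)))) (filonBeta (k * ((b - a) / (2 * N))))
            (filonGamma (k * ((b - a) / (2 * N))))

/-- The small-`θ` behaviour **(2.10.2.11)** (cited, NOT proved here): `α(θ) → 0`, `β(θ) → 2/3`, `γ(θ) → 4/3` as
`θ → 0`, `θ ≠ 0` (the leading terms of the three Taylor expansions).
[cite: DavisRabinowitz1984, Sect. 2.10.2 (2.10.2.11)] -/
def FilonSmallTheta : Prop :=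
  Tendsto filonAlpha (𝓝[≠] 0) (𝓝 0) ∧ Tendsto filonBeta (𝓝[≠] 0) (𝓝 (2 / 3)) ∧
    Tendsto filonGamma (𝓝[≠] 0) (𝓝 (4 / 3))

/-- The error bound **(2.10.2.12c)** (cited, NOT proved here), in the form: for `f ∈ C³[a, b]` with `|f'''| ≤ M`
there is a constant `C` such that for every `N ≥ 1` with `θ = kh < 1` (`h = (b-a)/2N`) both Filon errors are at
most `(b - a) M H(θ) h³ + C h⁴`. [cite: DavisRabinowitz1984, Sect. 2.10.2 (2.10.2.12a)-(2.10.2.12c)] -/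
def FilonErrorBound (f : ℝ → ℝ) (a b k M : ℝ) : Prop :=
  ContDiffOn ℝ 3 f (Set.Icc a b) → (∀ t ∈ Set.Icc a b, |iteratedDerivWithin 3 f (Set.Icc a b) t| ≤ M) →
    ∃ C : ℝ, ∀ N : ℕ, 1 ≤ N →
      let h := (b - a) / (2 * N)
      let θ := k * h
      θ < 1 →
        |(∫ t in a..b, f t * cos (k * t)) - filonCos f a b N k (filonAlpha θ) (filonBeta θ) (filonGamma θ)| ≤
            (b - a) * M * filonH θ * h ^ 3 + C * h ^ 4 ∧
        |(∫ t in a..b, f t * sin (k * t)) - filonSin f a b N k (filonAlpha θ) (filonBeta θ) (filonGamma θ)| ≤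
            (b - a) * M * filonH θ * h ^ 3 + C * h ^ 4

end Literature.Analysis.Quadrature
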